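import Mathlib
import Summits.KontsevichZagierPeriods.KontsevichZagierPeriods.Theorems.SoloInformedParamCoinI
import Summits.KontsevichZagierPeriods.KontsevichZagierPeriods.Theorems.SoloInformedDefMoveIntegrandAdd
import HarnessLib

/-!
# Solo-informed (A390-ii): generator definability for ARBITRARY chains, I — realisation of
arbitrary representations and the integrand-additivity move (1b)

File F6g.  Two inputs of the real-parameter kernel for arbitrary `KZ_ℝ` chains:

* `soloInformed_exists_pterm_repI`: EVERY real integral representation (no boundedness) is
  I-denoted, `T.repI p₀ = r`, by an I-admissible parametrised term at some real parameter;
* `soloInformed_definableRelI_integrandAddRel`: conditional on the Lion–Rolin preparation fact,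
  every (unbounded) integrand-additivity move `[r] − [r₁] − [r₂] ∈ KZOver.integrandAddRel ℝ`
  satisfies the definability invariant `SoloInformedDefinableRelI` — the good set is cut out by
  I-admissibility (a `ℚ`-semialgebraic condition by KERNEL LEMMA I), equality of fibres and the
  graph-additivity clause.

References: [cite: KontsevichZagier2001, §1.2 rule (1)]; [cite: BochnakCosteRoy1998, Prop. 2.2.4];
[cite: ComteLionRolin2000, Thm. 3].
-/

noncomputable section

open Set MeasureTheory MvPolynomial Literature.ModelTheory.ExponentialFields
  Literature.NumberTheory.Transcendental

namespace Summit.KontsevichZagierPeriods.KontsevichZagierPeriods.Theorems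

/-! ### Realisation of arbitrary representations -/

/-- **Every real integral representation is I-denoted by an I-admissible parametrised term at
some real parameter.** [cite: KontsevichZagier2001, §1.1] -/
theorem soloInformed_exists_pterm_repI {d : ℕ} (r : KZOver.IntegralRep ℝ d) :
    ∃ (K : Type) (_ : Fintype K) (T : SoloInformedPTerm K d) (p₀ : K → ℝ),
      T.SoloInformedAdmI p₀ ∧ T.repI p₀ = r ∧ T.φ = r.integrand := by
  obtain ⟨K, _, T, p₀, -, hfib, hgraph, -, hφ⟩ :=
    soloInformed_exists_pterm_of_funOn r.isSemialgebraic_domain r.isSemialgebraicFunOn_integrand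
      r.integrand
  exact ⟨K, inferInstance, T, p₀,
    SoloInformedPTerm.admI_of_graph r hfib.symm (fun x hx => hgraph x (hfib ▸ hx)),
    SoloInformedPTerm.repI_eq_of_graph r hfib.symm (fun x hx => hgraph x (hfib ▸ hx))
      (fun x _ => by rw [hφ]), hφ⟩

namespace SoloInformedPTerm

variable {K : Type} {d : ℕ} {T : SoloInformedPTerm K d} {p : K → ℝ}

/-- At an I-admissible parameter the graph fibre over the fibre is the graph of the integrand of
the denoted representation. [cite: KontsevichZagier2001, §1.1] -/
theorem snoc_mem_gfibre_iff_of_admI (h : T.SoloInformedAdmI p) {x : Fin d → ℝ}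
    (hx : x ∈ T.fibre p) (t : ℝ) : Fin.snoc x t ∈ T.gfibre p ↔ t = (T.repI p).integrand x := by
  rw [repI_integrand h, hybrid_of_mem hx]
  exact ⟨fun ht => (gval_eq h.1 hx ht).symm, fun ht => ht ▸ snoc_gval_mem h.1 hx⟩

end SoloInformedPTerm

namespace SoloInformedPCombo

variable {K : Type} {n : ℕ}

/-- The element I-denoted by the three-term combination. [cite: KontsevichZagier2001, §1.2] -/
theorem comboI_three (T U₁ U₂ : SoloInformedPTerm K n) (p : K → ℝ) :
    (three T U₁ U₂).comboI p =
      KZOver.of (T.repI p) - KZOver.of (U₁.repI p) - KZOver.of (U₂.repI p) := by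
  show ∑ t : Fin 3, (three T U₁ U₂).coef t • KZOver.of (((three T U₁ U₂).term t).repI p) = _
  rw [Fin.sum_univ_three]
  simp only [three, Matrix.cons_val_zero, Matrix.cons_val_one, Matrix.head_cons,
    Matrix.cons_val_two, Matrix.tail_cons, one_zsmul, neg_zsmul, sub_eq_add_neg]

/-- I-admissibility of the three-term combination. [cite: KontsevichZagier2001, §1.1] -/
theorem admI_three {T U₁ U₂ : SoloInformedPTerm K n} {p : K → ℝ} (hT : T.SoloInformedAdmI p)
    (h₁ : U₁.SoloInformedAdmI p) (h₂ : U₂.SoloInformedAdmI p) :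
    (three T U₁ U₂).SoloInformedAdmI p := by
  intro t
  show ((![T, U₁, U₂] : Fin 3 → SoloInformedPTerm K n) t).SoloInformedAdmI p
  fin_cases t
  · exact hT
  · exact h₁
  · exact h₂

/-- A rational lift of the three-term combination from rational forms of its terms.
[cite: KontsevichZagier2001, §1.2] -/
theorem ratLiftI_three {T U₁ U₂ : SoloInformedPTerm K n} {p : K → ℝ}
    (q₀ q₁ q₂ : KZOver.IntegralRep ℚ n) (h₀ : q₀.baseChange ℝ = T.repI p)
    (h₁ : q₁.baseChange ℝ = U₁.repI p) (h₂ : q₂.baseChange ℝ = U₂.repI p)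
    (hrel : KZOver.of q₀ - KZOver.of q₁ - KZOver.of q₂ ∈ KZOver.relations ℚ) :
    (three T U₁ U₂).SoloInformedRatLiftI p := by
  refine ⟨fun t => (![q₀, q₁, q₂] : Fin 3 → KZOver.IntegralRep ℚ n) t, fun t => ?_, ?_⟩
  · show KZOver.IntegralRep.baseChange ℝ ((![q₀, q₁, q₂] : Fin 3 → KZOver.IntegralRep ℚ n) t) =
      ((![T, U₁, U₂] : Fin 3 → SoloInformedPTerm K n) t).repI p
    fin_cases t
    · exact h₀
    · exact h₁
    · exact h₂
  · show ∑ t : Fin 3, (three T U₁ U₂).coef t •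
      KZOver.of ((![q₀, q₁, q₂] : Fin 3 → KZOver.IntegralRep ℚ n) t) ∈ _
    rw [Fin.sum_univ_three]
    simpa only [three, Matrix.cons_val_zero, Matrix.cons_val_one, Matrix.head_cons,
      Matrix.cons_val_two, Matrix.tail_cons, one_zsmul, neg_zsmul, sub_eq_add_neg] using hrel

end SoloInformedPCombo

/-- The (1b) move over `k` from its side conditions read on base changes to `ℝ`.
[cite: KontsevichZagier2001, §1.2 rule (1)] -/
theorem soloInformed_mem_integrandAddRel_of_baseChange {k : Type*} [Field k] [Algebra k ℝ]
    {n : ℕ} {x y z : KZOver.IntegralRep k n} {A A₁ A₂ : KZOver.IntegralRep ℝ n}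
    (hx : x.baseChange ℝ = A) (hy : y.baseChange ℝ = A₁) (hz : z.baseChange ℝ = A₂)
    (hd₁ : A₁.domain = A.domain) (hd₂ : A₂.domain = A.domain)
    (hadd : EqOn A.integrand (A₁.integrand + A₂.integrand) A.domain) :
    KZOver.of x - KZOver.of y - KZOver.of z ∈ KZOver.integrandAddRel k := by
  subst hx hy hz
  exact ⟨n, x, y, z, hd₁, hd₂, hadd, rfl⟩

/-- **Definability of the integrand-additivity move (1b), arbitrary representations**
(conditional on the preparation fact). [cite: KontsevichZagier2001, §1.2 rule (1)] -/
theorem soloInformed_definableRelI_of_mem_integrandAddRel (hprep : semialgebraicPreparation)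
    {c : KZOver.FormalRep ℝ} (hc : c ∈ KZOver.integrandAddRel ℝ) :
    SoloInformedDefinableRelI c := by
  classical
  obtain ⟨n, r, r₁, r₂, hd₁, hd₂, hadd, rfl⟩ := hc
  obtain ⟨K₀, _, T₀, p₀, hA₀, hrep₀, -⟩ := soloInformed_exists_pterm_repI r
  obtain ⟨K₁, _, T₁, p₁, hA₁, hrep₁, -⟩ := soloInformed_exists_pterm_repI r₁
  obtain ⟨K₂, _, T₂, p₂, hA₂, hrep₂, -⟩ := soloInformed_exists_pterm_repI r₂
  -- common parameter space
  let θ₀ : K₀ → (K₀ ⊕ K₁) ⊕ K₂ := fun i => Sum.inl (Sum.inl i)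
  let θ₁ : K₁ → (K₀ ⊕ K₁) ⊕ K₂ := fun i => Sum.inl (Sum.inr i)
  let θ₂ : K₂ → (K₀ ⊕ K₁) ⊕ K₂ := Sum.inr
  let T := T₀.pullback θ₀
  let U₁ := T₁.pullback θ₁
  let U₂ := T₂.pullback θ₂
  let q : (K₀ ⊕ K₁) ⊕ K₂ → ℝ := Sum.elim (Sum.elim p₀ p₁) p₂
  have hq₀ : q ∘ θ₀ = p₀ := rfl
  have hq₁ : q ∘ θ₁ = p₁ := rfl
  have hq₂ : q ∘ θ₂ = p₂ := Sum.elim_comp_inr _ _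
  have hTrep : ∀ p, T.repI p = T₀.repI (p ∘ θ₀) := fun p => SoloInformedPTerm.repI_pullback _ _ _
  have hU₁rep : ∀ p, U₁.repI p = T₁.repI (p ∘ θ₁) := fun p =>
    SoloInformedPTerm.repI_pullback _ _ _
  have hU₂rep : ∀ p, U₂.repI p = T₂.repI (p ∘ θ₂) := fun p =>
    SoloInformedPTerm.repI_pullback _ _ _
  have hTadm : ∀ p, T.SoloInformedAdmI p ↔ T₀.SoloInformedAdmI (p ∘ θ₀) := fun p =>
    SoloInformedPTerm.admI_pullback_iff _ _ _
  have hU₁adm : ∀ p, U₁.SoloInformedAdmI p ↔ T₁.SoloInformedAdmI (p ∘ θ₁) := fun p =>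
    SoloInformedPTerm.admI_pullback_iff _ _ _
  have hU₂adm : ∀ p, U₂.SoloInformedAdmI p ↔ T₂.SoloInformedAdmI (p ∘ θ₂) := fun p =>
    SoloInformedPTerm.admI_pullback_iff _ _ _
  -- the good set
  let V : Set ((K₀ ⊕ K₁) ⊕ K₂ → ℝ) := {p | T.SoloInformedAdmI p ∧ U₁.SoloInformedAdmI p ∧
    U₂.SoloInformedAdmI p ∧ U₁.fibre p = T.fibre p ∧ U₂.fibre p = T.fibre p ∧
    SoloInformedPTerm.SoloInformedAddClause T U₁ U₂ p}
  have hV : IsSemialgebraic ℚ V :=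
    soloInformed_isSemialgebraic_setOf_and (T.isSemialgebraic_setOf_admI hprep)
      (soloInformed_isSemialgebraic_setOf_and (U₁.isSemialgebraic_setOf_admI hprep)
      (soloInformed_isSemialgebraic_setOf_and (U₂.isSemialgebraic_setOf_admI hprep)
      (soloInformed_isSemialgebraic_setOf_and (SoloInformedPTerm.isSemialgebraic_setOf_fibre_eq _ _)
      (soloInformed_isSemialgebraic_setOf_and (SoloInformedPTerm.isSemialgebraic_setOf_fibre_eq _ _)
      (SoloInformedPTerm.isSemialgebraic_setOf_addClause _ _ _)))))
  -- side conditions on `V`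
  have hside : ∀ p ∈ V, (T.repI p).domain = (U₁.repI p).domain ∧
      (T.repI p).domain = (U₂.repI p).domain ∧
      EqOn (T.repI p).integrand ((U₁.repI p).integrand + (U₂.repI p).integrand)
        (T.repI p).domain := by
    rintro p ⟨hT, h₁, h₂, hf₁, hf₂, hcl⟩
    rw [SoloInformedPTerm.repI_domain hT, SoloInformedPTerm.repI_domain h₁,
      SoloInformedPTerm.repI_domain h₂, hf₁, hf₂]
    refine ⟨rfl, rfl, fun x hx => ?_⟩
    rw [Pi.add_apply, SoloInformedPTerm.repI_integrand hT, SoloInformedPTerm.repI_integrand h₁,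
      SoloInformedPTerm.repI_integrand h₂, SoloInformedPTerm.hybrid_of_mem hx,
      SoloInformedPTerm.hybrid_of_mem (hf₁.symm ▸ hx : x ∈ U₁.fibre p),
      SoloInformedPTerm.hybrid_of_mem (hf₂.symm ▸ hx : x ∈ U₂.fibre p)]
    exact SoloInformedPTerm.gval_eq_add_of_addClause hcl hT.1 h₁.1 h₂.1 hx (hf₁.symm ▸ hx)
      (hf₂.symm ▸ hx)
  refine ⟨(K₀ ⊕ K₁) ⊕ K₂, inferInstance, SoloInformedPCombo.three T U₁ U₂, q, V, hV, ?_, ?_, ?_, ?_⟩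
  · -- the original parameter is good
    have hT : T.SoloInformedAdmI q := (hTadm q).2 (hq₀ ▸ hA₀)
    have h₁ : U₁.SoloInformedAdmI q := (hU₁adm q).2 (hq₁ ▸ hA₁)
    have h₂ : U₂.SoloInformedAdmI q := (hU₂adm q).2 (hq₂ ▸ hA₂)
    have hTq : T.repI q = r := by rw [hTrep, hq₀, hrep₀]
    have h₁q : U₁.repI q = r₁ := by rw [hU₁rep, hq₁, hrep₁]
    have h₂q : U₂.repI q = r₂ := by rw [hU₂rep, hq₂, hrep₂]
    have hfT : T.fibre q = r.domain := by rw [← SoloInformedPTerm.repI_domain hT, hTq]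
    have hf₁ : U₁.fibre q = r.domain := by rw [← SoloInformedPTerm.repI_domain h₁, h₁q, hd₁]
    have hf₂ : U₂.fibre q = r.domain := by rw [← SoloInformedPTerm.repI_domain h₂, h₂q, hd₂]
    refine ⟨hT, h₁, h₂, hf₁.trans hfT.symm, hf₂.trans hfT.symm, ?_⟩
    refine SoloInformedPTerm.addClause_of_graphs (g := r.integrand) (g₁ := r₁.integrand)
      (g₂ := r₂.integrand) (fun x hx t => ?_) (fun x hx t => ?_) (fun x hx t => ?_)
      (fun x hx => hadd (hfT ▸ hx))
    · rw [SoloInformedPTerm.snoc_mem_gfibre_iff_of_admI hT hx, hTq]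
    · rw [SoloInformedPTerm.snoc_mem_gfibre_iff_of_admI h₁ (hf₁.symm ▸ hfT ▸ hx), h₁q]
    · rw [SoloInformedPTerm.snoc_mem_gfibre_iff_of_admI h₂ (hf₂.symm ▸ hfT ▸ hx), h₂q]
  · -- it denotes `c`
    rw [SoloInformedPCombo.comboI_three, hTrep, hU₁rep, hU₂rep, hq₀, hq₁, hq₂, hrep₀, hrep₁,
      hrep₂]
  · -- every good parameter denotes a (1b) move over `ℝ`
    rintro p hp
    obtain ⟨hd₁', hd₂', hadd'⟩ := hside p hp
    obtain ⟨hT, h₁, h₂, -, -, -⟩ := hp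
    refine ⟨SoloInformedPCombo.admI_three hT h₁ h₂, ?_⟩
    rw [SoloInformedPCombo.comboI_three]
    exact KZOver.integrandAddRel_subset_relations
      (soloInformed_mem_integrandAddRel_of_baseChange (soloInformed_baseChange_real _)
        (soloInformed_baseChange_real _) (soloInformed_baseChange_real _)
        hd₁'.symm hd₂'.symm hadd')
  · -- rational lift at parameters with rational fibres
    rintro p hp hRF
    obtain ⟨hd₁', hd₂', hadd'⟩ := hside p hp
    obtain ⟨hT, h₁, h₂, -, -, -⟩ := hp
    obtain ⟨hS₀, hG₀⟩ := soloInformedRatFibres.fibre hRF T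
    obtain ⟨hS₁, hG₁⟩ := soloInformedRatFibres.fibre hRF U₁
    obtain ⟨hS₂, hG₂⟩ := soloInformedRatFibres.fibre hRF U₂
    refine SoloInformedPCombo.ratLiftI_three (SoloInformedPTerm.ratRepI hS₀ hG₀ hT)
      (SoloInformedPTerm.ratRepI hS₁ hG₁ h₁) (SoloInformedPTerm.ratRepI hS₂ hG₂ h₂)
      (SoloInformedPTerm.baseChange_ratRepI _ _ _) (SoloInformedPTerm.baseChange_ratRepI _ _ _)
      (SoloInformedPTerm.baseChange_ratRepI _ _ _) ?_
    exact KZOver.integrandAddRel_subset_relations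
      (soloInformed_mem_integrandAddRel_of_baseChange
        (SoloInformedPTerm.baseChange_ratRepI _ _ _) (SoloInformedPTerm.baseChange_ratRepI _ _ _)
        (SoloInformedPTerm.baseChange_ratRepI _ _ _) hd₁'.symm hd₂'.symm hadd')

/-- **The (1b) hypothesis of THEOREM R / T for arbitrary chains, discharged** (conditional on the
preparation fact). [cite: KontsevichZagier2001, §1.2] -/
theorem soloInformed_definableRelI_integrandAddRel (hprep : semialgebraicPreparation) :
    ∀ c ∈ KZOver.integrandAddRel ℝ, SoloInformedDefinableRelI c :=
  fun _ hc => soloInformed_definableRelI_of_mem_integrandAddRel hprep hc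

end Summit.KontsevichZagierPeriods.KontsevichZagierPeriods.Theorems
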